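import Mathlib
import Summits.Ventures.HodgeRepro.Tier4.Common.AdelicDefs
import Summits.Ventures.HodgeRepro.Tier4.Common.AdelicRTF
import Summits.Ventures.HodgeRepro.Tier4.Common.SettingOfData
import Summits.Ventures.HodgeRepro.Tier4.Line1.RTFSetting
import Summits.Ventures.HodgeRepro.Tier4.Line1.PlaneDefs
import Summits.Ventures.HodgeRepro.Tier4.Line1.QuotientCompact
import Summits.Ventures.HodgeRepro.Tier4.Line1.DefinedContentOfData

/-!
# Tier4/Line1/RealisedSetting — the TREE TWINS of LINE L1's Part I′ instance setting (Skeleton-v0.32.lean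
L750–L957), sorry-free: `Setting.ofAdelic` on p5's `quotient_compact_genuine`, the bridges, J1 / J2 on it (the Part II /
Part III datum structures are the companion module `RealisedDatum.lean`)

Blind re-derivation cell `pub-hodge-repro`, Tier 4 (README §9–§10), seat t4-L1-p3 (gen 2); planner's ruling
t4-plan-1 g1 S13331 («YES, TREE TWINS […] the datum's setting = typer-2's `Setting.ofAdelicData` with
`DG := Classical.choose (quotient_compact_genuine pl hdef hgen μ)`»).  Target tree path
`lean/Summits/Ventures/HodgeRepro/Tier4/Line1/RealisedSetting.lean`.

WHAT IS HERE, AND WHAT CHANGED AGAINST THE SKELETON (disclosed for the critics' byte diff).  Every STATEMENT below is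
byte-identical to Skeleton-v0.32.lean (3df9a1eb68393900 · 1257), Part I′ from L750 `variable [MeasurableSpace (GA W)]
[BorelSpace (GA W)]` to L957 `end Instance`.  Exactly FIVE proof terms differ: (1) `Setting.ofAdelic` is no longer a
structure instance whose `DG` is `Classical.choose (quotient_compact …)` of the skeleton's declared wall — it is
typer-2's sorry-free `Setting.ofAdelicData W R μ DG fdG compG hT hT'` at
`DG := Classical.choose (quotient_compact_genuine W hW hg μ)` (t4-L1-p5's QuotientCompact: (I1-c) with
`IsDefinite ∧ IsGenuineRow`, the tree twin of the skeleton's `quotient_compact`); its fields `Gk, T, T', Z, μ, μT, μT',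
DT, DT'` and the proofs `discrete`, `closed`, `ZleT`, `ZleT'`, `central` are the same terms, `rightInv` is
`isMulRightInvariant_of_isFundamentalDomain` instead of the skeleton's `haar_rightInvariant` (both from (I1-c));
(2)–(5) `exists_adaptedONB`, `orbitOf_eq_of_conj`, `exists_isolating_nbhd`, `exists_isolating_tests` are the `_ofData`
theorems of `DefinedContentOfData` (p677159) instantiated at that `DG` — the skeleton's own proofs, line for line, over
`Setting.ofAdelicData`.  NOT here (they stay in the skeleton): the declared statements `quotient_compact`,
`torus_quotient_compact`, `torus'_quotient_compact`, `haar_rightInvariant` (closed there by name).  The generic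
assembly (`J_eq_orbital_of_isolated`, `exists_periods_of_isolation`) and `isRegularRational_of_isLinRegular` are
imported from `DefinedContentOfData` under the skeleton's names.
Nothing here says anything about the status of the Hodge conjecture for CM abelian varieties, which is NOT proved
(HC_CM is NOT proved by anyone in this repository).
-/

set_option autoImplicit false

noncomputable section

namespace Summit.Ventures.HodgeRepro.Tier4.Line1

open NumberField Common MeasureTheory Topology

section Instance

variable {k : Type} [Field k] [NumberField k] (W : PlaneData k)

variable [MeasurableSpace (GA W)] [BorelSpace (GA W)]

/-- **The generic setting of Line 1 on the defined adelic objects**: `Gk = U(W)(k)`, `T`, `T′`, `Z` of `AdelicDefs`,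
the torus measures and fundamental domains of an `RTFData`, a Haar measure on `U(W)(𝔸_k)` with the fundamental domain of
(I1-c); the content fields are the (I1) theorems. -/
def Setting.ofAdelic (hW : IsDefinite W) (hg : IsGenuineRow W) (R : RTFData W) (μ : Measure (GA W)) [μ.IsHaarMeasure]
    [R.μT.IsHaarMeasure] [R.μT'.IsHaarMeasure] (hT : IsCompact (closure R.DT))
    (hT' : IsCompact (closure R.DT')) : RTF.Setting (GA W) :=
  Setting.ofAdelicData W R μ (Classical.choose (quotient_compact_genuine W hW hg μ))
    (Classical.choose_spec (quotient_compact_genuine W hW hg μ)).1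
    (Classical.choose_spec (quotient_compact_genuine W hW hg μ)).2 hT hT'

variable (hW : IsDefinite W) (hg : IsGenuineRow W) (R : RTFData W) (μ : Measure (GA W)) [μ.IsHaarMeasure]
  [R.μT.IsHaarMeasure] [R.μT'.IsHaarMeasure] (hT : IsCompact (closure R.DT))
  (hT' : IsCompact (closure R.DT'))

/-- bridge (PROVED, `rfl`): the generic kernel on the instance IS typer-2's `kernel`. -/
theorem kernel_ofAdelic (f : GA W → ℂ) (x y : GA W) :
    (Setting.ofAdelic W hW hg R μ hT hT').kernel f x y = Common.kernel W f x y := rfl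

/-- bridge (PROVED, `rfl`): the generic right regular action on the instance IS typer-2's `rightRegular`. -/
theorem R_ofAdelic (f φ : GA W → ℂ) (x : GA W) :
    (Setting.ofAdelic W hW hg R μ hT hT').R f φ x = Common.rightRegular W μ f φ x := rfl

/-- bridge (PROVED): the generic `χ`-functional on the instance IS typer-2's `toricPeriod` against `conj χ`. -/
theorem periodT_ofAdelic (χ a : torusT W → ℂ) :
    (Setting.ofAdelic W hW hg R μ hT hT').periodT χ a =
      Common.toricPeriod W R.μT R.DT (fun t => starRingEnd ℂ (χ t)) a := by
  unfold RTF.Setting.periodT Common.toricPeriod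
  exact MeasureTheory.integral_congr_ae (Filter.Eventually.of_forall fun t => mul_comm _ _)

omit [MeasurableSpace (GA W)] [BorelSpace (GA W)] in
/-- bridge (PROVED): a test function in the generic sense IS typer-2's `IsTestFn`. -/
theorem isTest_iff (f : GA W → ℂ) : RTF.IsTest f ↔ Common.IsTestFn W f :=
  ⟨fun h => ⟨h.cont, h.compact⟩, fun h => ⟨h.1, h.2⟩⟩

/-- bridge (PROVED): the character `chi` of an `RTFData`, continuous and unitary, is an `IsCharacter` of the instance
(`chi_mul`, `chi_rational` are its fields). -/
theorem isCharacter_ofAdelic (hc : Continuous R.chi) (hu : ∀ a, ‖R.chi a‖ = 1) :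
    (Setting.ofAdelic W hW hg R μ hT hT').IsCharacter R.chi :=
  ⟨hc, R.chi_mul, hu, fun a ha => R.chi_rational a (Subgroup.mem_subgroupOf.mp ha)⟩

/-- bridge (PROVED): the same for `chi'`. -/
theorem isCharacter'_ofAdelic (hc : Continuous R.chi') (hu : ∀ a, ‖R.chi' a‖ = 1) :
    (Setting.ofAdelic W hW hg R μ hT hT').IsCharacter' R.chi' :=
  ⟨hc, R.chi'_mul, hu, fun a ha => R.chi'_rational a (Subgroup.mem_subgroupOf.mp ha)⟩

/-- bridge (PROVED): N2 of the `RTFData` IS `CentralMatch` on the instance. -/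
theorem centralMatch_ofAdelic : (Setting.ofAdelic W hW hg R μ hT hT').CentralMatch R.chi R.chi' :=
  R.chi_centre

/-- instance corollary of L1.1 (PROVED from the generic lemma; every object DEFINED): the relative trace formula
distribution of the face is the finite sum of the rational double-coset terms. -/
theorem rtf_geometric_adelic (hc : Continuous R.chi) (hu : ∀ a, ‖R.chi a‖ = 1) (hc' : Continuous R.chi')
    (hu' : ∀ a, ‖R.chi' a‖ = 1) {f : GA W → ℂ} (hf : Common.IsTestFn W f) :
    (Setting.ofAdelic W hW hg R μ hT hT').J R.chi R.chi' f =
      ∑ᶠ o, (Setting.ofAdelic W hW hg R μ hT hT').orbital R.chi R.chi' o f :=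
  (Setting.ofAdelic W hW hg R μ hT hT').rtf_geometric (isCharacter_ofAdelic W hW hg R μ hT hT' hc hu)
    (isCharacter'_ofAdelic W hW hg R μ hT hT' hc' hu') ((isTest_iff W f).mpr hf)

/-- instance corollary of L1.2b (PROVED from the generic lemma): the spectral expansion of `J(f₁ ⋆ f₂)` on `[U(W)]`. -/
theorem rtf_spectral_adelic (hc : Continuous R.chi) (hu : ∀ a, ‖R.chi a‖ = 1) (hc' : Continuous R.chi')
    (hu' : ∀ a, ‖R.chi' a‖ = 1) {τ : ℕ → Set (GA W → ℂ)} {φ : ℕ → GA W → ℂ} {n : ℕ → ℕ}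
    (hB : (Setting.ofAdelic W hW hg R μ hT hT').IsAdaptedONB τ φ n) {f₁ f₂ : GA W → ℂ}
    (h₁ : Common.IsTestFn W f₁) (h₂ : Common.IsTestFn W f₂) :
    HasSum (fun j => (Setting.ofAdelic W hW hg R μ hT hT').periodT' R.chi'
        (fun t' => (Setting.ofAdelic W hW hg R μ hT hT').R (RTF.refl f₂) (φ j) t') *
      starRingEnd ℂ ((Setting.ofAdelic W hW hg R μ hT hT').periodT R.chi
        (fun t => (Setting.ofAdelic W hW hg R μ hT hT').R (RTF.cj f₁) (φ j) t)))
      ((Setting.ofAdelic W hW hg R μ hT hT').J R.chi R.chi' ((Setting.ofAdelic W hW hg R μ hT hT').conv f₁ f₂)) :=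
  (Setting.ofAdelic W hW hg R μ hT hT').rtf_spectral (isCharacter_ofAdelic W hW hg R μ hT hT' hc hu)
    (isCharacter'_ofAdelic W hW hg R μ hT hT' hc' hu') hB ((isTest_iff W f₁).mpr h₁) ((isTest_iff W f₂).mpr h₂)

/-- (J1-hinf, prover-facing, M — t4-L1-p5, S12636, module Tier4/Line1/L2Infinite.lean): **`L²` of a fundamental domain of
`U(W)(k)` in `U(W)(𝔸_k)` is infinite-dimensional** — `GA W ⊇ ∏_v {±1}` (place-wise sign choices commute with `Ω` and preserve
`B`), an infinite compact subgroup without isolated points, so `GA W` is not discrete and its Haar measure has no atoms;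
`μ(DG) > 0` (`IsFundamentalDomain.measure_ne_zero`, `Countable (rationalPoints W)` = (I1-e)); an atomless finite measure
on a set of positive measure carries infinitely many disjoint subsets of positive measure, whose indicators are linearly
independent in `L²`.  The R4 witness of S12626/S12636 (a finite group) is exactly what this instance fact excludes. -/
/- (J1-hinf) — CLOSED by name: `Line1.not_finiteDimensional_L2_DG`, Tier4/Line1/L2InfiniteGA.lean (t4-L1-p5, p669681 with
L2Infinite, SignAdele p669222; S12785).  v0.24: the landed statement carries the RELATIVE COMPACTNESS of the domain
(`hDc : IsCompact (closure DG)` — the Haar measure of `DG` is then finite) and no `hW`; the instance supplies it from (I1-c)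
(`quotient_compact`, second component).  Statement of record (v0.19–v0.23) + `hDc`: -/
example (μ : Measure (GA W)) [μ.IsHaarMeasure] (DG : Set (GA W))
    (hDG : IsFundamentalDomain (rationalPoints W) DG μ) (hDc : IsCompact (closure DG)) :
    ¬ FiniteDimensional ℂ (Lp ℂ 2 (μ.restrict DG)) :=
  not_finiteDimensional_L2_DG W μ hDG hDc

/-- (J1, glue — PROVED in v0.19 from L4-p1's generic `exists_adaptedONB_of_rungs`, the wall (4b) on the instance and p5's
`lp_not_finiteDimensional`; v0.8–v0.18 declared it prover-facing L): **the discrete spectrum of the compact quotient** — an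
adapted orthonormal family of continuous `U(W)(k)`-invariant functions, complete in `L²(DG)`, along IRREDUCIBLE invariant
subspaces, exists (GGPS ch. 1 §2: for `f ∈ C_c` the operator `R(f)` on `L²([G])` is compact, `L²([G])` is the Hilbert direct
sum of irreducible invariant subspaces, each of finite multiplicity, and the smooth vectors are dense; `τ m` := the `m`-th
summand, `φ` an orthonormal basis of continuous vectors listed across the summands). -/
theorem exists_adaptedONB (hW : IsDefinite W) (hg : IsGenuineRow W) (R : RTFData W) (μ : Measure (GA W)) [μ.IsHaarMeasure]
    [R.μT.IsHaarMeasure] [R.μT'.IsHaarMeasure] (hT : IsCompact (closure R.DT))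
    (hT' : IsCompact (closure R.DT')) :
    ∃ (τ : ℕ → Set (GA W → ℂ)) (φ : ℕ → GA W → ℂ) (n : ℕ → ℕ),
      (Setting.ofAdelic W hW hg R μ hT hT').IsAdaptedONB τ φ n :=
  exists_adaptedONB_ofData W R μ _ _ _ hT hT'

/-- (J2.b, glue — PROVED in v0.17 from the core `exists_rational_conj` through `DoubleCoset.eq`; v0.10–v0.16 declared it a
print wall — Galois cohomology `ker (H¹(k, Z) → H¹(k, T × T′))` / Chebotarev — which the linear-algebra core makes
unnecessary): **two rational points of one adelic `T × T′`-orbit lie in one rational double coset** for `γ₀` linearly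
regular. -/
theorem orbitOf_eq_of_conj (hW : IsDefinite W) (hg : IsGenuineRow W) (R : RTFData W) (μ : Measure (GA W))
    [μ.IsHaarMeasure] [R.μT.IsHaarMeasure] [R.μT'.IsHaarMeasure] (hT : IsCompact (closure R.DT))
    (hT' : IsCompact (closure R.DT')) (γ γ₀ : rationalPoints W) (hreg : IsLinRegular W γ₀)
    (h : ∃ t ∈ torusT W, ∃ t' ∈ torusT' W, t⁻¹ * γ * t' = γ₀) :
    (Setting.ofAdelic W hW hg R μ hT hT').orbitOf γ = (Setting.ofAdelic W hW hg R μ hT hT').orbitOf γ₀ :=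
  orbitOf_eq_of_conj_ofData W R μ _ _ _ hT hT' hW hg γ γ₀ hreg h

/-- (J2.d′, glue — PROVED in v0.11 from the generic `exists_isolating_nbhd_of_hasse` (finiteness + Hausdorff) and J2.b
(the Hasse principle); (I1-f/g) supply the topology): **an isolating neighbourhood of every regular rational element**. -/
theorem exists_isolating_nbhd (hW : IsDefinite W) (hg : IsGenuineRow W) (R : RTFData W) (μ : Measure (GA W))
    [μ.IsHaarMeasure] [R.μT.IsHaarMeasure] [R.μT'.IsHaarMeasure] (hT : IsCompact (closure R.DT))
    (hT' : IsCompact (closure R.DT')) (γ₀ : rationalPoints W) (hreg : IsLinRegular W γ₀) :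
    ∃ U : Set (GA W), IsOpen U ∧ (γ₀ : GA W) ∈ U ∧
      ∀ t ∈ closure R.DT, ∀ t' ∈ closure R.DT', ∀ γ : rationalPoints W,
        (t : GA W)⁻¹ * γ * t' ∈ U →
          (Setting.ofAdelic W hW hg R μ hT hT').orbitOf γ = (Setting.ofAdelic W hW hg R μ hT hT').orbitOf γ₀ :=
  exists_isolating_nbhd_ofData W R μ _ _ _ hT hT' hW hg γ₀ hreg

/-- (J2, glue — PROVED from J2.c′, J2.d′, (I1-e/f/g) and `orbital_eq_zero_of_not_mem`; v0.10 ADDS the hypothesis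
`hγ : ∃ γ₀, IsRegularRational W γ₀` (v0.17: `IsLinRegular`, and `hg : IsGenuineRow W` for J2.b; v0.21: `hγ` is no longer a binder — it is
supplied inside by `exists_regular_rational W hW hg`, so the glue needs only `hW` and `hg`), because the v0.8 statement WITHOUT the regular element is FALSE: for the junk plane `P 0 = 0` the tori
are `G`, there is one double coset, its orbital term is `J(f) = (∫ f) · ∫_{[G]} χ · conj χ′`, and with `χ ≠ χ′` agreeing on
the centre — `χ = det_{v₁} det_{v₂}`, `χ′ = 1` on `O(4)(𝔸_ℚ)` — this vanishes for every `f`): **isolating test functions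
exist** — for the defined tori and characters (continuous,
unitary, N2) there are test functions `f₁`, `f₂` and ONE rational double coset `o₀` such that `f₁ ⋆ f₂` meets exactly
`o₀` on `DT × DT′` and the orbital term of `o₀` is non-zero.  `o₀ = [γ₀]` for the regular `γ₀` of J2.d′; `⊆` of the
geometric support is the isolating neighbourhood (`tsupport (f₁ ⋆ f₂) ⊆ U`), `∋` is forced by the non-zero orbital term.
The v0.8 sub-cut (a)–(e) by places survives as the PROOF PLAN of J2.c′/J2.d′, not as their statements: no place
decomposition is needed to STATE the heart.  F2′ (FREE refinement, not typed here: `f₁` can be taken with the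
admissible projector `e_S` as its `S`-components, typer-2's `IsIdempotentFor` of AdelicPlaces v0.5) is what makes the
free pin `lift` of Part II true for the datum. -/
theorem exists_isolating_tests (hW : IsDefinite W) (hg : IsGenuineRow W) (R : RTFData W) (μ : Measure (GA W))
    [μ.IsHaarMeasure] [R.μT.IsHaarMeasure] [R.μT'.IsHaarMeasure] (hT : IsCompact (closure R.DT))
    (hT' : IsCompact (closure R.DT')) (hc : Continuous R.chi) (hu : ∀ a, ‖R.chi a‖ = 1)
    (hc' : Continuous R.chi') (hu' : ∀ a, ‖R.chi' a‖ = 1) :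
    ∃ (f₁ f₂ : GA W → ℂ) (o₀ : (Setting.ofAdelic W hW hg R μ hT hT').Orbit),
      RTF.IsTest f₁ ∧ RTF.IsTest f₂ ∧ RTF.IsTest ((Setting.ofAdelic W hW hg R μ hT hT').conv f₁ f₂) ∧
      (Setting.ofAdelic W hW hg R μ hT hT').geoSupport ((Setting.ofAdelic W hW hg R μ hT hT').conv f₁ f₂) = {o₀} ∧
      (Setting.ofAdelic W hW hg R μ hT hT').orbital R.chi R.chi' o₀
        ((Setting.ofAdelic W hW hg R μ hT hT').conv f₁ f₂) ≠ 0 :=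
  exists_isolating_tests_ofData W R μ _ _ _ hT hT' hW hg hc hu hc' hu'

end Instance

end Summit.Ventures.HodgeRepro.Tier4.Line1

end
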